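import Summits.CriticalPhenomena.Ising3DConformalLimit.Theses.MarkovRigidity
import Summits.CriticalPhenomena.Ising3DConformalLimit.Theorems.HyperoctahedralRPTwoPointKernelOfLimitClauses
import Literature.Probability.LatticeModels.CriticalAxisRatioRegularity
import Literature.Probability.LatticeModels.RegularScales
import Literature.Probability.LatticeModels.CriticalTwoPointBounds
import Summits.CriticalPhenomena.Ising3DConformalLimit.Theorems.MoebiusLimitOfTwoPointLaw.Negative.CanonicalForm
import HarnessLib

/-!
# Route MarkovRigidity, support item `FieldRealisation` (stmt-CriticalPhenomena-11245):
# a mesh-uniform bound on the renormalised critical two-point kernel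

First helper towards clause (b) of `FieldRealisation` (realising a pointwise scaling limit `S` of
the critical `ℤ³` Ising correlators as the moment densities of a law on `𝒮'(ℝ³)`): the smeared
`n`-point sums converge to `∫ Sₙ ∏ fᵢ` only if the renormalised pair kernel `ρ(δ)² ⟨σ₀σ_u⟩_{β_c}`
is dominated, UNIFORMLY IN THE MESH `δ`, by a locally integrable function of `δu`.  Main result
`rho_sq_mul_criticalTwoPoint_le`: there are `2 ≤ a < 3`, `C`, `δ₀ > 0` with
`ρ(δ)² ⟨σ₀σ_u⟩_{β_c} ≤ C · max(1, (δ · max(1, ‖u‖_∞))^{-a})` for `0 < δ < δ₀`, `u ∈ ℤ³`, whenever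
`S` is non-degenerate and scale covariant with `0 < Δ < 3/2`.
Proof: Messager–Miracle-Solé (`⟨σ₀σ_u⟩ ≤ ⟨σ₀σ_{‖u‖_∞e₀}⟩`, tree) and monotonicity along the axis
(tree, log-convexity); DYADIC DOUBLING `⟨σ₀σ_{2^{k+2}e₀}⟩ ≥ 2^{-(2Δ+η)}⟨σ₀σ_{2^{k+1}e₀}⟩` for large
`k` from the limit (`tendsto_rescaled_dyadic`, `S_two_unitVec_eq`), iterated between the dyadic
scales below `‖u‖_∞` and above `⌊1/δ⌋`; at the scale `⌊1/δ⌋` the renormalised kernel converges, and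
the Simon–Lieb lower bound `⟨σ₀σ_x⟩ ≥ c‖x‖^{-2}` (tree) gives `ρ(δ)² ≤ Cδ^{-2}` for the small
separations (exponent `2 ≤ a`).  References: Messager–Miracle-Solé, J. Stat. Phys. 17 (1977);
Aizenman–Duminil-Copin, Ann. Math. 194 (2021) §5.5; Glimm–Jaffe 1987 §6.1.  No definitions.
-/

noncomputable section

namespace Summit.CriticalPhenomena.Ising3DConformalLimit.MarkovRigidityFieldRealisation

open Literature.Probability.LatticeModels
open Summit.CriticalPhenomena.Ising3DConformalLimit
open Filter Set
open scoped Topology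

variable {ρ : ℝ → ℝ} {Δ : ℝ} {S : CorrFamily 3}

/-! ### The critical axis two-point function is non-increasing -/

/-- `⟨σ₀σ_{n e₀}⟩_{β_c} ≤ ⟨σ₀σ_{m e₀}⟩_{β_c}` for `1 ≤ m ≤ n` (iterate `criticalTwoPoint_axis_succ_le`).
[cite: AizenmanDuminilCopinAnnals2021, arXiv:1912.07973 §5.5 proof of Prop. 5.9 (p. 19)] -/
theorem criticalTwoPoint_axis_antitone {m n : ℕ} (hm : 1 ≤ m) (hmn : m ≤ n) :
    criticalTwoPoint 3 (Pi.single (0 : Fin 3) (n : ℤ)) ≤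
      criticalTwoPoint 3 (Pi.single (0 : Fin 3) (m : ℤ)) := by
  induction n, hmn using Nat.le_induction with
  | base => exact le_rfl
  | succ n hmn ih =>
    obtain ⟨k, rfl⟩ : ∃ k, n = k + 1 := ⟨n - 1, by omega⟩
    exact (criticalTwoPoint_axis_succ_le (0 : Fin 3) k).trans ih

/-- Messager–Miracle-Solé in the critical plus state: `⟨σ₀σ_u⟩_{β_c} ≤ ⟨σ₀σ_{‖u‖_∞ e₀}⟩_{β_c}`.
[cite: MessagerMiracleSoleJSP1977, main theorem (monotonicity of ⟨σ₀σ_x⟩ under reflections)] -/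
theorem criticalTwoPoint_le_axis (u : Site 3) :
    criticalTwoPoint 3 u ≤ criticalTwoPoint 3 (Pi.single (0 : Fin 3) (Site.supNorm u : ℤ)) := by
  have h1 := twoPointPlus_criticalBeta_eq_twoPointFree_holds (d := 3) le_rfl
  rw [criticalTwoPoint, criticalTwoPoint, h1, h1]
  exact twoPointFree_le_single_of_le (d := 3) (criticalBeta_nonneg 3) (by norm_num : 1 ≤ 3) le_rfl

/-! ### Dyadic doubling from the scaling limit -/

/-- **Dyadic doubling of the critical axis two-point function.**  If `S` is a pointwise scaling
limit of `criticalCorr 3` which is non-degenerate and scale covariant with dimension `Δ`, then for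
every `q < 2^{-2Δ}` eventually `q · ⟨σ₀σ_{2^{k+1}e₀}⟩ ≤ ⟨σ₀σ_{2^{k+2}e₀}⟩`. [folklore] -/
theorem eventually_doubling (hlim : HasPointwiseScalingLimit (criticalCorr 3) ρ S)
    (hnd : IsNondegenerateTwoPoint S) (hsc : IsScaleCovariant Δ S) {q : ℝ}
    (hq : q < (2 : ℝ) ^ (-(2 : ℝ) * Δ)) :
    ∀ᶠ k : ℕ in atTop, q * criticalTwoPoint 3 (Pi.single (0 : Fin 3) ((2 : ℤ) ^ (k + 1))) ≤
      criticalTwoPoint 3 (Pi.single (0 : Fin 3) ((2 : ℤ) ^ (k + 2))) := by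
  set s₁ := S 2 ![0, EuclideanSpace.single (0 : Fin 3) ((1 : ℕ) : ℝ)] with hs₁
  have hs₁pos : 0 < s₁ := hnd _ (zero_unitVec_mem_nonCoincident (by norm_num))
  -- `ρ(δ_k)² G(2^{k+2} e) → 2^{-2Δ} s₁`
  have hnum := tendsto_rescaled_dyadic hlim (t := 2) two_ne_zero
  rw [S_two_unitVec_eq hsc] at hnum
  -- `ρ(δ_k)² G(2^{k+1} e) → s₁`
  have hden := tendsto_rescaled_dyadic hlim (t := 1) one_ne_zero
  have h2 : ∀ k : ℕ, ((2 : ℕ) : ℤ) * 2 ^ (k + 1) = (2 : ℤ) ^ (k + 2) := by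
    intro k; push_cast; ring
  have h1 : ∀ k : ℕ, ((1 : ℕ) : ℤ) * 2 ^ (k + 1) = (2 : ℤ) ^ (k + 1) := by
    intro k; push_cast; ring
  simp only [h2] at hnum
  simp only [h1] at hden
  -- the difference `ρ² G(2^{k+2}e) - q ρ² G(2^{k+1} e)` tends to a positive limit
  have hdiff := hnum.sub (hden.const_mul q)
  have hpos : 0 < (2 : ℝ) ^ (-(2 : ℝ) * Δ) * s₁ - q * s₁ := by
    rw [← sub_mul]; exact mul_pos (sub_pos.2 hq) hs₁pos
  have hev := hdiff.eventually (lt_mem_nhds hpos)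
  filter_upwards [hev] with k hk
  rcases (sq_nonneg (ρ (2⁻¹ ^ (k + 1)))).eq_or_lt with h0 | hpos'
  · exfalso; rw [← h0] at hk; simp at hk
  · have : 0 < ρ (2⁻¹ ^ (k + 1)) ^ 2 * (criticalTwoPoint 3 (Pi.single 0 (2 ^ (k + 2))) -
        q * criticalTwoPoint 3 (Pi.single 0 (2 ^ (k + 1)))) := by nlinarith [hk]
    have := (mul_pos_iff_of_pos_left hpos').1 this
    linarith

/-- **Power comparison along the axis** from dyadic doubling beyond `2^{K₀+1}`: for
`2^{K₀+1} ≤ m ≤ M`, `q ^ (log₂ M - log₂ m + 1) · ⟨σ₀σ_{me₀}⟩ ≤ ⟨σ₀σ_{Me₀}⟩`. [folklore] -/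
theorem axis_le_of_doubling {q : ℝ} (hq0 : 0 < q) {K₀ : ℕ}
    (hdbl : ∀ k, K₀ ≤ k → q * criticalTwoPoint 3 (Pi.single (0 : Fin 3) ((2 : ℤ) ^ (k + 1))) ≤
      criticalTwoPoint 3 (Pi.single (0 : Fin 3) ((2 : ℤ) ^ (k + 2))))
    {m M : ℕ} (hm : 2 ^ (K₀ + 1) ≤ m) (hmM : m ≤ M) :
    q ^ (Nat.log 2 M - Nat.log 2 m + 1) * criticalTwoPoint 3 (Pi.single (0 : Fin 3) (m : ℤ)) ≤
      criticalTwoPoint 3 (Pi.single (0 : Fin 3) (M : ℤ)) := by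
  -- dyadic brackets `2^i ≤ m < 2^{i+1}`, `2^j ≤ M < 2^{j+1}` with `K₀ + 1 ≤ i ≤ j`
  set i := Nat.log 2 m with hi
  set j := Nat.log 2 M with hj
  have hm0 : m ≠ 0 := (lt_of_lt_of_le (Nat.two_pow_pos _) hm).ne'
  have hM0 : M ≠ 0 := by omega
  have him : 2 ^ i ≤ m := Nat.pow_log_le_self 2 hm0
  have hmi : m < 2 ^ (i + 1) := Nat.lt_pow_succ_log_self (by norm_num) m
  have hjM : 2 ^ j ≤ M := Nat.pow_log_le_self 2 hM0
  have hMj : M < 2 ^ (j + 1) := Nat.lt_pow_succ_log_self (by norm_num) M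
  have hK₀i : K₀ + 1 ≤ i := by
    rw [hi]; exact Nat.le_log_of_pow_le (by norm_num) hm
  have hij : i ≤ j := Nat.log_mono_right hmM
  -- iterate the doubling from `2^i` up to `2^{j+1}`
  have hchain : ∀ n : ℕ, q ^ n * criticalTwoPoint 3 (Pi.single (0 : Fin 3) ((2 : ℤ) ^ i)) ≤
      criticalTwoPoint 3 (Pi.single (0 : Fin 3) ((2 : ℤ) ^ (i + n))) := by
    intro n
    induction n with
    | zero => simp
    | succ n ih =>
      obtain ⟨i', hi'⟩ : ∃ i', i = i' + 1 := ⟨i - 1, by omega⟩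
      have hk : K₀ ≤ i' + n := by omega
      have hd := hdbl (i' + n) hk
      have e1 : i' + n + 1 = i + n := by omega
      have e2 : i' + n + 2 = i + (n + 1) := by omega
      rw [e1] at hd; rw [e2] at hd
      calc q ^ (n + 1) * criticalTwoPoint 3 (Pi.single 0 (2 ^ i))
          = q * (q ^ n * criticalTwoPoint 3 (Pi.single 0 (2 ^ i))) := by ring
        _ ≤ q * criticalTwoPoint 3 (Pi.single 0 (2 ^ (i + n))) :=
            mul_le_mul_of_nonneg_left ih hq0.le
        _ ≤ _ := hd
  -- `G(m) ≤ G(2^i)` and `G(2^{j+1}) ≤ G(M)` by monotonicity along the axis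
  have hG1 : criticalTwoPoint 3 (Pi.single (0 : Fin 3) (m : ℤ)) ≤
      criticalTwoPoint 3 (Pi.single (0 : Fin 3) ((2 : ℤ) ^ i)) := by
    have := criticalTwoPoint_axis_antitone (m := 2 ^ i) (n := m) (Nat.one_le_two_pow) him
    push_cast at this
    exact this
  have hG2 : criticalTwoPoint 3 (Pi.single (0 : Fin 3) ((2 : ℤ) ^ (i + (j - i + 1)))) ≤
      criticalTwoPoint 3 (Pi.single (0 : Fin 3) (M : ℤ)) := by
    have e : i + (j - i + 1) = j + 1 := by omega
    rw [e]
    have := criticalTwoPoint_axis_antitone (m := M) (n := 2 ^ (j + 1)) (by omega) hMj.le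
    push_cast at this
    exact this
  have hqn : 0 ≤ q ^ (j - i + 1) := pow_nonneg hq0.le _
  calc q ^ (j - i + 1) * criticalTwoPoint 3 (Pi.single (0 : Fin 3) (m : ℤ))
      ≤ q ^ (j - i + 1) * criticalTwoPoint 3 (Pi.single (0 : Fin 3) ((2 : ℤ) ^ i)) :=
        mul_le_mul_of_nonneg_left hG1 hqn
    _ ≤ criticalTwoPoint 3 (Pi.single (0 : Fin 3) ((2 : ℤ) ^ (i + (j - i + 1)))) := hchain _
    _ ≤ _ := hG2

/-! ### The mesh-uniform kernel bound -/

/-- **Mesh-uniform domination of the renormalised critical pair kernel.**  Let `S` be a pointwise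
scaling limit of `criticalCorr 3` under `ρ`, non-degenerate and scale covariant with dimension
`0 < Δ < 3/2`.  Then there are an exponent `2 ≤ a < 3`, a constant `C` and a mesh `δ₀ > 0` such that
for all `0 < δ < δ₀` and all `u ∈ ℤ³`,
`ρ(δ)² ⟨σ₀σ_u⟩_{β_c} ≤ C · max(1, (δ · max(1, ‖u‖_∞))^{-a})`.
In continuum units `w = δu` this is domination by the locally integrable `max(1, ‖w‖^{-a})`,
uniformly in the mesh. [cite: GlimmJaffe1987, §6.1] -/
theorem rho_sq_mul_criticalTwoPoint_le (hlim : HasPointwiseScalingLimit (criticalCorr 3) ρ S)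
    (hnd : IsNondegenerateTwoPoint S) (hsc : IsScaleCovariant Δ S) (hΔ0 : 0 < Δ) (hΔ : Δ < 3 / 2) :
    ∃ a C δ₀ : ℝ, 2 ≤ a ∧ a < 3 ∧ 0 < C ∧ 0 < δ₀ ∧
      ∀ δ : ℝ, 0 < δ → δ < δ₀ → ∀ u : Site 3,
        ρ δ ^ 2 * criticalTwoPoint 3 u ≤ C * max 1 ((δ * max 1 (Site.supNorm u : ℝ)) ^ (-a)) := by
  -- exponents
  set a' : ℝ := 2 * Δ + (3 - 2 * Δ) / 2 with ha'
  have ha'pos : 0 < a' := by rw [ha']; linarith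
  have ha'3 : a' < 3 := by rw [ha']; linarith
  set a : ℝ := max 2 a' with ha
  have ha2 : 2 ≤ a := le_max_left _ _
  have ha3 : a < 3 := max_lt (by norm_num) ha'3
  have ha'a : a' ≤ a := le_max_right _ _
  -- the doubling ratio `q = 2^{-a'} < 2^{-2Δ}`
  set q : ℝ := (2 : ℝ) ^ (-a') with hq
  have hq0 : 0 < q := Real.rpow_pos_of_pos two_pos _
  have hqlt : q < (2 : ℝ) ^ (-(2 : ℝ) * Δ) := by
    rw [hq]
    exact Real.rpow_lt_rpow_of_exponent_lt one_lt_two (by rw [ha']; linarith)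
  obtain ⟨K₀, hK₀⟩ := eventually_atTop.1 (eventually_doubling hlim hnd hsc hqlt)
  -- the scale of the mesh: `ρ(δ)² G(⌊1/δ⌋ e₀) → s₁ > 0`
  set s₁ := S 2 ![0, EuclideanSpace.single (0 : Fin 3) (1 : ℝ)] with hs₁
  have hx : (![0, EuclideanSpace.single (0 : Fin 3) (1 : ℝ)] : Fin 2 → EuclideanSpace ℝ (Fin 3)) ∈
      NonCoincident 3 2 := by
    have := zero_unitVec_mem_nonCoincident (t := ((1 : ℕ) : ℝ)) (by norm_num)
    simpa using this
  have hs₁pos : 0 < s₁ := hnd _ hx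
  have hT : Tendsto (fun δ => ρ δ ^ 2 * criticalTwoPoint 3 (Pi.single (0 : Fin 3) ⌊1 / δ⌋))
      (𝓝[>] 0) (𝓝 s₁) := by
    have h := (hlim 2).tendsto_at hx
    simp_rw [Theorems.MoebiusLimitOfTwoPointLaw.Negative.rescaledCorrelator_criticalCorr_unitVec] at h
    exact h
  -- the Simon–Lieb lower bound
  obtain ⟨c, C', hc, hbd⟩ := criticalTwoPoint_bounds_holds (d := 3) le_rfl
  -- eventually in the mesh: scale control and `δ` small
  have hev : ∀ᶠ δ in 𝓝[>] (0 : ℝ), ρ δ ^ 2 * criticalTwoPoint 3 (Pi.single (0 : Fin 3) ⌊1 / δ⌋) ≤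
      2 * s₁ ∧ (0 < δ ∧ δ < (2 : ℝ)⁻¹ ^ (K₀ + 2)) := by
    refine ((hT.eventually (gt_mem_nhds (by linarith : s₁ < 2 * s₁))).mono fun δ h => h.le).and ?_
    have h1 : ∀ᶠ δ in 𝓝[>] (0 : ℝ), 0 < δ := eventually_mem_nhdsWithin
    have h2 : ∀ᶠ δ in 𝓝[>] (0 : ℝ), δ < (2 : ℝ)⁻¹ ^ (K₀ + 2) :=
      (eventually_lt_nhds (by positivity)).filter_mono nhdsWithin_le_nhds
    exact h1.and h2
  obtain ⟨δ₀, hδ₀, hδ₀P⟩ := (nhdsGT_basis (0 : ℝ)).eventually_iff.1 hev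
  -- constants
  set N₀ : ℕ := 2 ^ (K₀ + 1) with hN₀
  set C₁ : ℝ := 2 * s₁ / c with hC₁def
  have hC₁ : 0 < C₁ := div_pos (by linarith) hc
  have h4 : 0 < (4 : ℝ) ^ a' := Real.rpow_pos_of_pos (by norm_num) a'
  set C : ℝ := C₁ * (N₀ : ℝ) ^ 2 + 2 * s₁ * (4 : ℝ) ^ a' + 2 * s₁ with hC
  have hCpos : 0 < C := by positivity
  have hCge1 : C₁ * (N₀ : ℝ) ^ 2 ≤ C := by rw [hC]; nlinarith
  have hCge2 : 2 * s₁ * (4 : ℝ) ^ a' ≤ C := by rw [hC]; nlinarith [sq_nonneg (N₀ : ℝ)]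
  have hCge3 : 2 * s₁ ≤ C := by rw [hC]; nlinarith [sq_nonneg (N₀ : ℝ)]
  refine ⟨a, C, δ₀, ha2, ha3, hCpos, hδ₀, fun δ hδ hδδ₀ u => ?_⟩
  obtain ⟨hscale, -, hδsmall⟩ := hδ₀P ⟨hδ, hδδ₀⟩
  -- the mesh scale `M = ⌊1/δ⌋ ≥ 2^{K₀+2}`
  set M : ℕ := ⌊1 / δ⌋₊ with hM
  have hMint : (⌊1 / δ⌋ : ℤ) = (M : ℤ) := by
    rw [hM, Int.natCast_floor_eq_floor (by positivity)]
  have hMge : 2 ^ (K₀ + 2) ≤ M := by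
    rw [hM]
    refine Nat.le_floor ?_
    rw [Nat.cast_pow, Nat.cast_two, le_one_div (by positivity) hδ, one_div, ← inv_pow]
    exact hδsmall.le
  have hM1 : 1 ≤ M := le_trans Nat.one_le_two_pow hMge
  have hMle : (M : ℝ) ≤ 1 / δ := Nat.floor_le (by positivity)
  have hδM : δ * M ≤ 1 := by
    rw [mul_comm]; exact (le_div_iff₀ hδ).1 hMle
  -- `ρ(δ)² G(M e₀) ≤ 2 s₁` and `ρ(δ)² ≤ C₁ δ⁻²`
  have hscale' : ρ δ ^ 2 * criticalTwoPoint 3 (Pi.single (0 : Fin 3) (M : ℤ)) ≤ 2 * s₁ := by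
    rw [← hMint]; exact hscale
  have hGM : c * δ ^ 2 ≤ criticalTwoPoint 3 (Pi.single (0 : Fin 3) (M : ℤ)) := by
    have hx0 : (Pi.single (0 : Fin 3) (M : ℤ) : Site 3) ≠ 0 := by
      intro h
      have := congr_fun h 0
      simp only [Pi.single_eq_same, Pi.zero_apply, Nat.cast_eq_zero] at this
      omega
    have hlow := (hbd _ hx0).1
    have hnorm : ‖(Pi.single (0 : Fin 3) (M : ℤ) : Site 3)‖ = M := by
      rw [norm_single_axis]; simp
    rw [hnorm] at hlow
    refine le_trans ?_ hlow
    refine mul_le_mul_of_nonneg_left ?_ hc.le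
    have hMpos : (0 : ℝ) < M := by exact_mod_cast hM1
    have e3 : (-(((3 : ℕ) : ℝ) - 1)) = -((2 : ℕ) : ℝ) := by norm_num
    rw [e3, Real.rpow_neg hMpos.le, Real.rpow_natCast]
    rw [show δ ^ 2 = (δ⁻¹ ^ 2)⁻¹ by rw [inv_pow, inv_inv]]
    exact inv_anti₀ (by positivity) (pow_le_pow_left₀ hMpos.le (by rwa [← one_div]) 2)
  have hρsq : ρ δ ^ 2 ≤ C₁ * δ⁻¹ ^ 2 := by
    have h1 : ρ δ ^ 2 * (c * δ ^ 2) ≤ 2 * s₁ :=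
      le_trans (mul_le_mul_of_nonneg_left hGM (sq_nonneg _)) hscale'
    have hcδ : 0 < c * δ ^ 2 := by positivity
    calc ρ δ ^ 2 = ρ δ ^ 2 * (c * δ ^ 2) / (c * δ ^ 2) := by field_simp
      _ ≤ 2 * s₁ / (c * δ ^ 2) := div_le_div_of_nonneg_right h1 hcδ.le
      _ = C₁ * δ⁻¹ ^ 2 := by rw [hC₁def]; field_simp
  have hG1 : criticalTwoPoint 3 u ≤ 1 := criticalTwoPoint_le_one' u
  -- three regimes for `m = ‖u‖_∞`
  set m : ℕ := Site.supNorm u with hm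
  have hrhs1 : C * 1 ≤ C * max 1 ((δ * max 1 (m : ℝ)) ^ (-a)) :=
    mul_le_mul_of_nonneg_left (le_max_left _ _) hCpos.le
  rcases lt_or_ge m N₀ with hsmall | hlarge
  · -- small separations: `ρ² G ≤ ρ² ≤ C₁ δ⁻² ≤ C₁ N₀² (δ max(1,m))^{-a}`
    have hmN : max 1 (m : ℝ) ≤ N₀ := by
      refine max_le ?_ ?_
      · exact_mod_cast Nat.one_le_two_pow
      · exact_mod_cast hsmall.le
    have hle1 : δ * max 1 (m : ℝ) ≤ 1 := by
      have hN₀M : (N₀ : ℝ) ≤ M := by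
        rw [hN₀]; exact_mod_cast le_trans (Nat.pow_le_pow_right two_pos (by omega)) hMge
      calc δ * max 1 (m : ℝ) ≤ δ * M := mul_le_mul_of_nonneg_left (hmN.trans hN₀M) hδ.le
        _ ≤ 1 := hδM
    have hpos : 0 < δ * max 1 (m : ℝ) := by positivity
    have hpow : (δ * max 1 (m : ℝ)) ^ (-(2 : ℝ)) ≤ (δ * max 1 (m : ℝ)) ^ (-a) :=
      Real.rpow_le_rpow_of_exponent_ge hpos hle1 (by linarith)
    have hkey : ρ δ ^ 2 ≤ C₁ * (N₀ : ℝ) ^ 2 * (δ * max 1 (m : ℝ)) ^ (-(2 : ℝ)) := by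
      rw [Real.rpow_neg hpos.le, show (2 : ℝ) = ((2 : ℕ) : ℝ) by norm_num, Real.rpow_natCast, mul_pow]
      have hmN2 : (max 1 (m : ℝ)) ^ 2 ≤ (N₀ : ℝ) ^ 2 := pow_le_pow_left₀ (by positivity) hmN 2
      have hmx : 0 < (max 1 (m : ℝ)) ^ 2 := by positivity
      calc ρ δ ^ 2 ≤ C₁ * δ⁻¹ ^ 2 := hρsq
        _ = C₁ * (max 1 (m : ℝ)) ^ 2 * (δ ^ 2 * (max 1 (m : ℝ)) ^ 2)⁻¹ := by
            field_simp
        _ ≤ C₁ * (N₀ : ℝ) ^ 2 * (δ ^ 2 * (max 1 (m : ℝ)) ^ 2)⁻¹ := by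
            gcongr
    calc ρ δ ^ 2 * criticalTwoPoint 3 u ≤ ρ δ ^ 2 := mul_le_of_le_one_right (sq_nonneg _) hG1
      _ ≤ C₁ * (N₀ : ℝ) ^ 2 * (δ * max 1 (m : ℝ)) ^ (-a) :=
          hkey.trans (mul_le_mul_of_nonneg_left hpow (by positivity))
      _ ≤ C * (δ * max 1 (m : ℝ)) ^ (-a) := mul_le_mul_of_nonneg_right hCge1 (by positivity)
      _ ≤ C * max 1 ((δ * max 1 (m : ℝ)) ^ (-a)) :=
          mul_le_mul_of_nonneg_left (le_max_right _ _) hCpos.le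
  · -- `m ≥ N₀ ≥ 1`: compare with the axis
    have hm1 : 1 ≤ m := le_trans Nat.one_le_two_pow hlarge
    have hmax : max 1 (m : ℝ) = m := max_eq_right (by exact_mod_cast hm1)
    have hMMS : criticalTwoPoint 3 u ≤ criticalTwoPoint 3 (Pi.single (0 : Fin 3) (m : ℤ)) :=
      criticalTwoPoint_le_axis u
    rcases le_or_gt m M with hmM | hMm
    · -- intermediate separations: doubling between `m` and `M`
      have hdbl := axis_le_of_doubling hq0 hK₀ hlarge hmM
      set n : ℕ := Nat.log 2 M - Nat.log 2 m + 1 with hn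
      have hqn : 0 < q ^ n := pow_pos hq0 n
      -- `2^n ≤ 4 M / m`
      have h2n : (2 : ℝ) ^ n ≤ 4 * M / m := by
        have hm0 : m ≠ 0 := by omega
        have hM0 : M ≠ 0 := by omega
        have hlogM : 2 ^ Nat.log 2 M ≤ M := Nat.pow_log_le_self 2 hM0
        have hlogm : m < 2 ^ (Nat.log 2 m + 1) := Nat.lt_pow_succ_log_self (by norm_num) m
        have hmpos : (0 : ℝ) < m := by exact_mod_cast Nat.pos_of_ne_zero hm0
        rw [le_div_iff₀ hmpos]
        have key : 2 ^ n * m ≤ 4 * M := by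
          calc 2 ^ n * m ≤ 2 ^ n * 2 ^ (Nat.log 2 m + 1) := Nat.mul_le_mul_left _ hlogm.le
            _ = 4 * 2 ^ Nat.log 2 M := by
                rw [hn, ← pow_add,
                  show Nat.log 2 M - Nat.log 2 m + 1 + (Nat.log 2 m + 1) = Nat.log 2 M + 2 by
                    have := Nat.log_mono_right (b := 2) hmM; omega,
                  pow_add]
                ring
            _ ≤ 4 * M := Nat.mul_le_mul_left _ hlogM
        exact_mod_cast key
      -- `q^{-n} = (2^n)^{a'} ≤ (4M/m)^{a'} ≤ 4^{a'} (δ m)^{-a'} ≤ 4^{a'} (δ m)^{-a}`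
      have hδm1 : δ * m ≤ 1 := le_trans (mul_le_mul_of_nonneg_left (by exact_mod_cast hmM) hδ.le) hδM
      have hmpos : (0 : ℝ) < m := by exact_mod_cast hm1
      have hδmpos : 0 < δ * m := by positivity
      have hqinv : (q ^ n)⁻¹ ≤ (4 : ℝ) ^ a' * (δ * m) ^ (-a) := by
        have e1 : (q ^ n)⁻¹ = ((2 : ℝ) ^ n) ^ a' := by
          rw [hq, ← Real.rpow_natCast ((2:ℝ) ^ (-a')) n, ← Real.rpow_mul (by norm_num),
            ← Real.rpow_neg (by norm_num), ← Real.rpow_natCast (2:ℝ) n,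
            ← Real.rpow_mul (by norm_num)]
          congr 1; ring
        rw [e1]
        calc ((2 : ℝ) ^ n) ^ a' ≤ (4 * M / m) ^ a' :=
              Real.rpow_le_rpow (by positivity) h2n ha'pos.le
          _ ≤ (4 * (δ * m)⁻¹) ^ a' := by
              refine Real.rpow_le_rpow (by positivity) ?_ ha'pos.le
              rw [mul_div_assoc, mul_inv]
              refine mul_le_mul_of_nonneg_left ?_ (by norm_num)
              rw [div_eq_mul_inv]
              refine mul_le_mul_of_nonneg_right ?_ (by positivity)
              rwa [← one_div]
          _ = (4 : ℝ) ^ a' * (δ * m) ^ (-a') := by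
              rw [Real.mul_rpow (by norm_num) (by positivity), Real.rpow_neg hδmpos.le,
                Real.inv_rpow hδmpos.le]
          _ ≤ (4 : ℝ) ^ a' * (δ * m) ^ (-a) := by
              refine mul_le_mul_of_nonneg_left ?_ h4.le
              exact Real.rpow_le_rpow_of_exponent_ge hδmpos hδm1 (by linarith)
      have hGm : criticalTwoPoint 3 (Pi.single (0 : Fin 3) (m : ℤ)) ≤
          (q ^ n)⁻¹ * criticalTwoPoint 3 (Pi.single (0 : Fin 3) (M : ℤ)) := by
        rw [le_inv_mul_iff₀ hqn]; exact hdbl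
      calc ρ δ ^ 2 * criticalTwoPoint 3 u
          ≤ ρ δ ^ 2 * criticalTwoPoint 3 (Pi.single (0 : Fin 3) (m : ℤ)) :=
            mul_le_mul_of_nonneg_left hMMS (sq_nonneg _)
        _ ≤ ρ δ ^ 2 * ((q ^ n)⁻¹ * criticalTwoPoint 3 (Pi.single (0 : Fin 3) (M : ℤ))) :=
            mul_le_mul_of_nonneg_left hGm (sq_nonneg _)
        _ = (q ^ n)⁻¹ * (ρ δ ^ 2 * criticalTwoPoint 3 (Pi.single (0 : Fin 3) (M : ℤ))) := by ring
        _ ≤ ((4 : ℝ) ^ a' * (δ * m) ^ (-a)) * (2 * s₁) :=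
            mul_le_mul hqinv hscale' (mul_nonneg (sq_nonneg _) (criticalTwoPoint_nonneg' _))
              (by positivity)
        _ = (2 * s₁ * (4 : ℝ) ^ a') * (δ * max 1 (m : ℝ)) ^ (-a) := by rw [hmax]; ring
        _ ≤ C * (δ * max 1 (m : ℝ)) ^ (-a) := mul_le_mul_of_nonneg_right hCge2 (by positivity)
        _ ≤ C * max 1 ((δ * max 1 (m : ℝ)) ^ (-a)) :=
            mul_le_mul_of_nonneg_left (le_max_right _ _) hCpos.le
    · -- large separations: `G(u) ≤ G(m e₀) ≤ G(M e₀)` and `ρ² G(M e₀) ≤ 2 s₁ ≤ C`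
      have hax := criticalTwoPoint_axis_antitone hM1 hMm.le
      calc ρ δ ^ 2 * criticalTwoPoint 3 u
          ≤ ρ δ ^ 2 * criticalTwoPoint 3 (Pi.single (0 : Fin 3) (M : ℤ)) :=
            mul_le_mul_of_nonneg_left (hMMS.trans hax) (sq_nonneg _)
        _ ≤ 2 * s₁ := hscale'
        _ ≤ C * 1 := by rw [mul_one]; exact hCge3
        _ ≤ _ := hrhs1

end Summit.CriticalPhenomena.Ising3DConformalLimit.MarkovRigidityFieldRealisation

end
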